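import Summits.BirchSwinnertonDyer.Rank1Residual.X11b.BDPRouteOpenInputFrame
import Summits.BirchSwinnertonDyer.Rank1Residual.X11b.RouteR1IntReceptacleOneSided
import HarnessLib

/-!
# Class X11b, route p2 at `p ≥ 5`: THE OPEN INPUT IN `R₀`-FREE FRAME FORM — per datum ONE BDP frame
# `Q ∈ 𝓞_{ℂ_p}⟦T⟧` with Cas18 Thm. 3.1's interpolation ∧ Thm. 3.2's value at `𝟙` ∧ the erratum's
# DIVISIBILITY (2.4); the route's records no longer carry `R₀` in the type of their open input
# (cell `b2b-bsdres`, sub-cell `multr1-p2`, gen 24)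

HONEST FRAMING (cell `b2b-bsdres`, run/shared/lean/b2b/bsd-rank1-residual/, verbatim in every
file): the goal of the cell is to DELETE the COMBINATION-SHAPED residual classes of the
Birch–Swinnerton-Dyer formula for ALL analytic-rank `≤ 1` elliptic curves over `ℚ` — "full BSD
formula for every rank `≤ 1` curve in class `C`" assembled STRICTLY from published theorems — so
that the rank-`≤ 1` remainder becomes exactly the CONSTRUCTION-SHAPED classes, which are TYPED
(missing-input `Prop`s), NOT attempted. This is not "finishing BSD". Sub-cell `multr1-p2` is a
RESEARCH ROUTE on class X11b (`ClassX11b W p := r_an = 1 ∧ p ≠ 2 ∧ mult(p) ∧ irr(p)`,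
`Partition/Rows.lean`); no claim beyond the stated class and loci; X11b's label does not change;
NOTHING is booked by this file.

ONE `Prop`-valued class-level SHAPE with a body (`P2.IMCDivIntFrameOnTree`, OPEN, conjecture-tagged
since gen 29 — claim-tagged in gens 24–28, see SCOPE below —, never a theorem in this cell) and
theorems; no named fact; no `sorry`. Every result using the shape is CONDITIONAL.

SCOPE OF THE ANNOUNCED DERIVATION (gen 29, doc + tag only; statements byte-identical; sources re-read
verbatim). The shape is asked at CLASSICAL Heegner data (`SatisfiesHeegnerHypothesis`: every `ℓ ∣ N_E`
split in `K`). The derivation its gen-24 docstring pointed at for the divisibility conjunct, the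
erratum's "(2.4) … By [FW21, Thm. 4.41]", carries Fouquet–Wan's hypothesis "there exists `q ∥ N` (in
particular `q ∤ p`) which is not split in `K`" (arXiv:2107.13726v3, Thm. 4.41, third hypothesis; the
full inclusion moreover wants every non-split `ℓ ∣ N` RAMIFIED in `K`, `π(f)_ℓ` special Steinberg
twisted by the unramified quadratic character), exactly as [Castella2018, p. 4] ("at least one prime
`q ∣ N` nonsplit in `K`") and [Castella2024, Thm. 3.1 (iii)] do; classical Heegner data EXCLUDE such a
`q`. So that derivation lives at route R1's ERRATUM fields and is typed there
(`P2.IMCDivIntFrameAtErratumData`, `X11b/BDPRouteErratumData.lean`, gen 28); at classical Heegner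
fields the published result in this direction is [BurungaleCastellaSkinner2025, Thm. 1.2.4]
(`ch(X_Gr) = (L_p^BDP)`, primes `p > 3` of GOOD ORDINARY reduction), whose multiplicative analogue
(`p ∥ N`) is in no source the cell holds, and the only printed statement in this direction at `p ∥ N`
is STEP L itself ([SkinnerZhang2014] Thm. 1.2, PREPRINT; `indexLowerBoundAt_of_skinnerZhang_OPEN`).
Hence: NO announced derivation of the divisibility conjunct at these data (the value conjunct keeps its
printed status: Cas18 Thm. 3.2 on semistable pairs, [Castella2024] PREPRINT beyond); the shape is
re-badged `@[conjecture]` (an instance of the Iwasawa–Greenberg main conjecture for `X_ac(E[p^∞])`,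
[Castella2018, §1 (1.b)], with the frame and value clauses); every record using it was and stays
CONDITIONAL on it; nothing else changes.

## Why a fourth currency (x11b3-lead R7-61 cross-lane notice; multr1-p1 GEN 23, INBOX 10:45Z)

Gen 23's frame form `P2.IMCDivFrameOnTree W p` (`BDPRouteOpenInputFrame.lean`) asks, per datum, for
a frame `(Ω_K, Ω_p ∈ R₀ˣ, L ∈ R₀⟦T⟧)`, `R₀ = 𝓞(\widehat{ℚ_p^ur})` — as do the halves (`UnrSeries`) and
the ∀-frame (2.4) `P2.IMCDivOnTree`. x11b3-lit1's L59 flags, at PRINT level, that for fields `K` with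
`k(K,p) ≥ 1` the printed construction of Castella's `L_p(f)` has coefficients in a ramified ring
`𝒲 ⊋ R₀` and "`L_p(f) ∈ Λ_{R₀}`" rests on an unwritten descent (referee's call; no mark). Route p2's
kernel inference to `BSD_p` is ONE-SIDED and reads only an upper bound on `‖f_ac(0)‖` in `ℂ_p`;
`R₀`-rationality of the frame was never load-bearing. multr1-p1 GEN 23 re-typed route R1 over
Hsieh's receptacle `𝓞_{ℂ_p}⟦T⟧` (`RouteR1IntReceptacle.lean`, `RouteR1IntFrame.lean`) and proved the
one-sided ♭-algebra for the divisibility routes (`RouteR1IntReceptacleOneSided.lean`: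
`R1.imcLowerWaldspurgerOnTreeAt_of_intValue_of_intDvd`), handing the `P2.…IntFrame` shape to this
seat. THIS FILE files it:

* §1 def **`P2.IMCDivIntFrameOnTree W p`** (H∃♭ for p2, OPEN shape, claim-tagged): at every datum of
  `P2OpenInputOnTreeAt W p`, every `(κ, γ, ι', w₀, P', e)` as in gen 23's frame form: THERE IS a frame
  `(Ω_K ≠ 0, Ω_p ∈ ℂ_p with ‖Ω_p‖ = 1, Q ∈ 𝓞_{ℂ_p}⟦T⟧)` with Castella's interpolation property
  `R1.IsBDPLFunctionInt` [Thm. 3.1♭] ∧ the value at `𝟙` `R1.BDPValueAtOneIntAt` [Thm. 3.2♭] ∧ the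
  DIVISIBILITY `Ch_Λ(X_ac^∅(E[p^∞]))·𝓞_{ℂ_p}⟦T⟧ ⊆ (Q)` [(2.4)♭].
* §2 **weaker than everything typed before**: `P2.imcDivIntFrameOnTree_of_imcDivFrame` (gen 23's
  `R₀`-frame read in `𝓞_{ℂ_p}⟦T⟧`), `…_of_halves`, `…_of_thm32_of_semistable`; and pointwise the
  EQUALITY shape of route R1 implies p2's divisibility (`P2.intDvd_of_imcEqIntAt`).
* §3 **`P2.openInputOnTreeAt_of_imcDivIntFrame`** — ANY pair: `hnf hGZK hKo hPT hEP` + H∃♭ ⟹ the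
  composite `P2OpenInputOnTreeAt W p` (gen 23's per-datum argument verbatim, the pointwise assembly
  now multr1-p1's `R1.imcLowerWaldspurgerOnTreeAt_of_intValue_of_intDvd` over `𝓞_{ℂ_p}⟦T⟧`);
  `P2.missingLowerBoundAt_of_imcDivIntFrame`; **`P2.bsdp_of_locus_of_imcDivIntFrame`** (ANY Locus
  pair, 2 093 111 ‖ 61 629: PUB + cited + H∃♭ at the pair — nothing per pair).

The per-pair closures off the Locus, the semistable end state and the class record over H∃♭ are the
companion file `BDPRouteOpenInputIntFrameRecord.lean`. WHAT IS OPEN in H∃♭, honestly: exactly what is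
open in gen 23's frame form ((2.4) for Castella's `L_p(f)` at CLASSICAL data — NO announced derivation,
SCOPE above; on non-semistable pairs also Thms. 3.1/3.2 beyond their printed square-free scope,
[Castella 2024, Thm. 3.1, §2.3] PREPRINT) MINUS the `R₀`-rationality of the frame: a refereed statement
about `L_p(f)` with coefficients in `R₀`, a finite extension `𝒲`, Hsieh's `Z̄_p` or `𝓞_{ℂ_p}` discharges
it alike. CONDITIONAL; deletes nothing; labels UNCHANGED; X11b stays CONSTRUCTION-SHAPED.

References: [Castella2018] §1 (1.b) (p. 3), p. 4, Thms. 2.3, 3.1, (3.2), 3.2, §5 (arXiv:1704.06608 pp.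
5, 9, 12); [Castella2018Erratum] (2.4), Thm. 1.1 (pp. 1, 4); [Castella2024] arXiv:2409.01360 Thm. 3.1,
§2.3 (PREPRINT); [Hsieh2014] Doc. Math. 19 (2014), p. 7 (`Λ = Z̄_p⟦Γ⁻⟧ ⊆ 𝓞_{ℂ_p}⟦T⟧`);
[FouquetWan2021] Thm. 4.41 (arXiv:2107.13726v3 p. 44; PREPRINT); [BurungaleCastellaSkinner2025] Thm.
1.2.4; [SkinnerZhang2014] Thm. 1.2 (PREPRINT); [Miller2011LMS] Def. 1.1.
-/

noncomputable section

open scoped Classical NumberField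

open WeierstrassCurve NumberField IsDedekindDomain Field PowerSeries
open Literature.NumberTheory.EllipticCurves Literature.NumberTheory.EllipticCurves.GreenbergSelmer
open Literature.NumberTheory.EllipticCurves.ModularForms
open Literature.NumberTheory.EllipticCurves.Rank1Residual
open Literature.NumberTheory.EllipticCurves.Rank1Residual.Typed
open Literature.NumberTheory.EllipticCurves.Wuthrich2014
open Literature.NumberTheory.EllipticCurves.Castella2018
open Literature.NumberTheory.EllipticCurves.SteinWuthrich2013
open Literature.NumberTheory.EllipticCurves.Disegni2020
open Literature.NumberTheory.EllipticCurves.Skinner2016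
open Literature.NumberTheory.EllipticCurves.BalakrishnanEtAl2019
open Literature.NumberTheory.QuadraticFields.Quadratic
open Literature.NumberTheory.GaloisRepresentations Literature.NumberTheory.GaloisCohomology
open Summit.BirchSwinnertonDyer.Rank1Residual.X11b.AcSelmer
open Summit.BirchSwinnertonDyer.Rank1Residual.X11b.CongruenceLimit
open Summit.BirchSwinnertonDyer.Rank1Residual.X11b.Halves

namespace Summit.BirchSwinnertonDyer.Rank1Residual.X11b

/-! ### §1 The open input of route p2 in `R₀`-free frame form (H∃♭, OPEN shape) -/

section Shape

variable (W : WeierstrassCurve ℚ) [W.IsElliptic] [W.IsGloballyMinimal] (p : ℕ) [Fact p.Prime]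

/-- **H∃♭ — route p2's open input in `R₀`-FREE FRAME FORM: Cas18 Thm. 3.1 ∧ Thm. 3.2 ∧ erratum (2.4)
for ONE frame `Q ∈ 𝓞_{ℂ_p}⟦T⟧`, per datum (OPEN shape, ∃∧-currency).** At every datum of
`P2OpenInputOnTreeAt W p` (`(E,p)` in X11b, `p ≥ 5`, `ρ̄_{E,p}` onto; `K` imaginary quadratic, `d_K`
odd, `p ∤ d_K`, `p ∤ #𝓞_K^×`, every `ℓ ∣ N_E` split, `L(E^{d_K},1) ≠ 0`; a parametrisation datum `Dt`
of level `N_E` with `p ∤ c`; `P` its Heegner point read through `ι`, non-torsion; anticyclotomic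
`(κ, γ)`), for every embedding datum `ι' : ℚ̄_p ≃ ℂ`, infinite place `w₀`, point `P'` read as
`heegnerPointComplex Dt H` through `w₀`, and `e : K → ℚ_p` inducing `𝔭_{ι'}`: THERE IS a frame
`(Ω_K ≠ 0, Ω_p ∈ ℂ_p with ‖Ω_p‖ = 1, Q ∈ 𝓞_{ℂ_p}⟦T⟧)` with Castella's interpolation property
`R1.IsBDPLFunctionInt p ι' 𝔭_{ι'} κ γ f_{Dt} Ω_K Ω_p Q` [Thm. 3.1, receptacle widened to Hsieh's
`𝓞_{ℂ_p}⟦T⟧`] ∧ `Q(𝟙) = u·((1 − a_p(E) p⁻¹)·log_{ω_E} P')²`, `‖u‖ = 1` [Thm. 3.2;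
`R1.BDPValueAtOneIntAt`] ∧ `Ch_Λ(X_ac^∅(E[p^∞]))·𝓞_{ℂ_p}⟦T⟧ ⊆ (Q)` for the constructed `X_ac` at
`𝔭_{ι'}` [the erratum's display (2.4) TRANSCRIBED to these classical data — NO announced derivation
here: the erratum's "(2.4) ⇐ [FW21, Thm. 4.41]" needs a prime `q ∥ N` NOT split in `K`; the announced
derivation is typed at erratum data as `P2.IMCDivIntFrameAtErratumData` (file docstring, SCOPE, gen
29)]. The ∃∧-transcription of "Thm. 3.1 ∧ Thm. 3.2 ∧ (2.4)" (one object `L_p(f)`) with NO rationality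
clause on its coefficient ring; implied by gen 23's `P2.IMCDivFrameOnTree`
(`P2.imcDivIntFrameOnTree_of_imcDivFrame`). Its divisibility conjunct is an instance of the
Iwasawa–Greenberg main conjecture for `X_ac(E[p^∞])` at `p ∥ N` and classical Heegner fields — the
multiplicative analogue of [BurungaleCastellaSkinner2025, Thm. 1.2.4] (good ordinary `p`), not in
print; a predicate on `(W, p)`; OPEN; NEVER a theorem in this cell; every result using it is
CONDITIONAL. (Gens 24–28 badged it as claimed-by-the-erratum — withdrawn gen 29: the erratum does not
state (2.4) at these data.)
[cite: Castella2018, §1 (1.b) (arXiv:1704.06608 p. 3) and Thm. 3.1, display (3.2), Thm. 3.2 (p. 9) (conjecture display, frame and value; shape only; nothing asserted)]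
[cite: Castella2018Erratum, (2.4) (p. 4) (display transcribed; its derivation there assumes a prime of N non-split in K; nothing asserted)]
[cite: Hsieh2014, p. 7 (arXiv:1112.1580) (the receptacle `Z̄_p⟦Γ⁻⟧ ⊆ 𝓞_{ℂ_p}⟦T⟧`)] -/
@[conjecture]
def P2.IMCDivIntFrameOnTree : Prop :=
  ∀ (N : ℕ) [NeZero N] (K : Type) [Field K] [NumberField K]
    (Dt : ModularParametrizationData W N) (H : HeegnerDatum N (NumberField.discr K)) (ι : K →+* ℂ)
    (P : (W.baseChange K).toAffine.Point),
    ClassX11b W p → 5 ≤ p → Surj W p → W.conductorNorm ℤ = N → IsImaginaryQuadratic K →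
    Odd (NumberField.discr K) → ¬ (p : ℤ) ∣ NumberField.discr K → ¬ p ∣ Units.torsionOrder K →
    SatisfiesHeegnerHypothesis N K →
    (W.quadraticTwist (NumberField.discr K : ℚ)).entireLFunction 1 ≠ 0 →
    WeierstrassCurve.Affine.Point.map ι.toRatAlgHom P = heegnerPointComplex Dt H →
    ¬ (p : ℤ) ∣ Dt.c → ¬ IsOfFinAddOrder P →
    ∀ (κ : ZpExtension K p), κ.IsAnticyclotomic →
      ∀ (γ : Field.absoluteGaloisGroup K) [Fact (κ.IsTopGenerator γ)]
        (ι' : PadicAlgCl p ≃+* ℂ) (w₀ : InfinitePlace K) (P' : (W.baseChange K).toAffine.Point),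
        WeierstrassCurve.Affine.Point.map w₀.embedding.toRatAlgHom P' = heegnerPointComplex Dt H →
        ∀ (e : K →+* ℚ_[p]),
          (∀ k : 𝓞 K, k ∈ (primeOfEmbeddingDatum p ι' w₀.embedding).asIdeal ↔ ‖e (k : K)‖ < 1) →
          ∃ (ΩK : ℂ) (Ωp : ℂ_[p]) (Q : PowerSeries 𝓞_ℂ_[p]), ΩK ≠ 0 ∧ ‖Ωp‖ = 1 ∧
            R1.IsBDPLFunctionInt p ι' (primeOfEmbeddingDatum p ι' w₀.embedding) κ γ Dt.f ΩK Ωp Q ∧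
            R1.BDPValueAtOneIntAt W p e P' Q (W.LFunction p) ∧
            (XAc.charIdeal (W.baseChange K) p κ (primeOfEmbeddingDatum p ι' w₀.embedding) ∅ γ).map
              (PowerSeries.map (R1.toCpInt p)) ≤ Ideal.span {Q}

end Shape

/-! ### §2 H∃♭ is weaker than the gen-23 frame form, the halves, and route R1's equality shape -/

section Weaker

variable {W : WeierstrassCurve ℚ} [W.IsElliptic] [W.IsGloballyMinimal] {p : ℕ} [Fact p.Prime]

/-- **Frame form ⟹ H∃♭.** Read gen 23's `R₀`-frame `(Ω_K, Ω_p ∈ R₀ˣ, L ∈ R₀⟦T⟧)` in `𝓞_{ℂ_p}⟦T⟧`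
along `R₀ ⊆ 𝓞_{ℂ_p}` (`R1.unrToCpInt`): same values (`R1.isBDPLFunctionInt_map`,
`R1.bdpValueAtOneIntAt_map`), the divisibility transfers (`R1.ideal_map_le_span_map_of_le`),
`‖Ω_p‖ = 1` for a unit of `R₀`. So H∃♭ is implied by, and not stronger than, gen 23's frame form.
CONDITIONAL on the frame form (open). [cite: Castella2018, Thm. 3.1 and Thm. 3.2 (arXiv:1704.06608 p. 9)]
[cite: Castella2018Erratum, (2.4) (p. 4)] -/
theorem P2.imcDivIntFrameOnTree_of_imcDivFrame (hF : P2.IMCDivFrameOnTree W p) :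
    P2.IMCDivIntFrameOnTree W p := by
  intro N _ K _ _ Dt H ιK P hX h5 hs hN hK hodd hpd hμ hHN hLt hP hc hPinf κ hκ γ _ ι' w₀ P' hP' e he
  obtain ⟨ΩK, Ωp, L, hΩ, hL, hval, hdiv⟩ :=
    hF N K Dt H ιK P hX h5 hs hN hK hodd hpd hμ hHN hLt hP hc hPinf κ hκ γ ι' w₀ P' hP' e he
  exact ⟨ΩK, ((Ωp : unrIntegers p) : ℂ_[p]), PowerSeries.map (R1.unrToCpInt p) L, hΩ,
    norm_coe_units_unrIntegers p Ωp, R1.isBDPLFunctionInt_map hL, R1.bdpValueAtOneIntAt_map hval,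
    R1.ideal_map_le_span_map_of_le p hdiv⟩

/-- **Halves ⟹ H∃♭** (any pair): gen 23's (H1∧H2) `P2.BDPValueOnTree` and the ∀-frame divisibility
`P2.IMCDivOnTree` give the frame form (`P2.imcDivFrameOnTree_of_halves`), whence H∃♭. CONDITIONAL on
both halves. [cite: Castella2018, Thms. 3.1–3.2 (arXiv:1704.06608 p. 9)] [cite: Castella2018Erratum, (2.4) (p. 4)] -/
theorem P2.imcDivIntFrameOnTree_of_halves (h2 : P2.BDPValueOnTree W p) (h3 : P2.IMCDivOnTree W p) :
    P2.IMCDivIntFrameOnTree W p :=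
  P2.imcDivIntFrameOnTree_of_imcDivFrame (P2.imcDivFrameOnTree_of_halves h2 h3)

/-- **`h32` + semistable + (2.4)∀ ⟹ H∃♭**: on a semistable pair the registered published fact (Cas18
Thms. 3.1–3.2) gives (H1∧H2), whence H∃♭ — the `R₀`-free input is also weaker than gen 23's
semistable inputs. CONDITIONAL on (2.4)∀ (open). [cite: Castella2018, Thms. 3.1–3.2 (arXiv:1704.06608 p. 9)]
[cite: Castella2018Erratum, (2.4) (p. 4)] -/
theorem P2.imcDivIntFrameOnTree_of_thm32_of_semistable
    (h32 : thm32_exists_isBDPLFunction_valueAtOne) (hss : Semistable W) (h3 : P2.IMCDivOnTree W p) :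
    P2.IMCDivIntFrameOnTree W p :=
  P2.imcDivIntFrameOnTree_of_imcDivFrame (P2.imcDivFrameOnTree_of_thm32_of_semistable h32 hss h3)

omit [W.IsElliptic] [W.IsGloballyMinimal] in
/-- **Pointwise, route R1's EQUALITY shape over `𝓞_{ℂ_p}⟦T⟧` implies route p2's divisibility** for the
same `Q` (`=` ⟹ `≤` on ideals): a refereed erratum Thm. 1.1 read in `𝓞_{ℂ_p}⟦T⟧` at a p2 datum would
give the third conjunct of H∃♭ there. [claim: Castella2018Erratum, status: under-review] -/
theorem P2.intDvd_of_imcEqIntAt {K : Type} [Field K] [NumberField K] {κ : ZpExtension K p}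
    {𝔭 : HeightOneSpectrum (𝓞 K)} {γ : Field.absoluteGaloisGroup K} [Fact (κ.IsTopGenerator γ)]
    {Q : PowerSeries 𝓞_ℂ_[p]} (h : R1.IMCEqIntAt W p κ 𝔭 γ Q) :
    (XAc.charIdeal (W.baseChange K) p κ 𝔭 ∅ γ).map (PowerSeries.map (R1.toCpInt p)) ≤
      Ideal.span {Q} :=
  le_of_eq h

end Weaker

/-! ### §3 Route p2's open input from H∃♭, on EVERY pair — no semistability, no `h32`, no `R₀` -/

section Composite

variable {W : WeierstrassCurve ℚ} [W.IsElliptic] [W.IsGloballyMinimal] {p : ℕ} [Fact p.Prime]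

/-- **The composite open input from H∃♭, with the one-sided control** (any pair): gen 23's proof of
`P2.openInputOnTreeAt_of_imcDivFrame_of_controlUpper` run on the ONE frame `Q ∈ 𝓞_{ℂ_p}⟦T⟧` the shape
provides at `(w₀, τ_* P, κ, γ, ι', embAt)` — value at `𝟙` and (2.4)♭ for the same `Q`, CTL₀ from the
one-sided control, assembly by multr1-p1's `R1.imcLowerWaldspurgerOnTreeAt_of_intValue_of_intDvd`
(norms in `ℂ_p`; the unit `u` is used only through `‖u‖ ≤ 1`), log-order invariance under `τ`. NO
`R₀`-rationality anywhere. CONDITIONAL on H∃♭.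
[cite: Castella2018, Thms. 2.3, 3.1, 3.2 and §5 (arXiv:1704.06608 pp. 5, 9, 12)]
[cite: Castella2018Erratum, (2.4) and Thm. 1.1 (pp. 1, 4)] -/
theorem P2.openInputOnTreeAt_of_imcDivIntFrame_of_controlUpper (hnf : exists_isNewformOf)
    (hGZK : rank_eq_analyticRank_of_analyticRank_le_one) (hC : P2ControlUpperOnTreeAt W p)
    (ι₀ : PadicAlgCl p ≃+* ℂ) (hF : P2.IMCDivIntFrameOnTree W p) : P2OpenInputOnTreeAt W p := by
  intro N _ K _ _ Dt H ιK P hX h5 hs hN hK hodd hpd hμ hHN hLt hP hc hPinf κ hκ γ _ 𝔭 h𝔭 he hf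
  obtain ⟨n, hn, -⟩ := hC N K Dt H ιK P hX h5 hs hN hK hodd hpd hμ hHN hLt hP hc hPinf κ hκ γ 𝔭 h𝔭 he hf
  have hF' := hF N K Dt H ιK P hX h5 hs hN hK hodd hpd hμ hHN hLt hP hc hPinf κ hκ γ
  subst hN
  obtain ⟨hr, -, -, -⟩ := hX
  obtain ⟨w₀⟩ := (inferInstance : Nonempty (InfinitePlace K))
  have hp2 : p ≠ 2 := by omega
  -- `rank_ℤ E(K) = 1` (Gross–Zagier–Kolyvagin)
  have hrk : (W.baseChange K).mordellWeilRank = 1 :=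
    mordellWeilRank_baseChange_eq_one_of_twist_ne_zero W hGZK hnf hr hK.1 hLt
  -- the datum's complex embedding is `w₀.embedding ∘ τ` for some `τ ∈ Gal(K/ℚ)`, `τ² = 1`
  haveI : IsGalois ℚ K := by
    haveI : Algebra.IsQuadraticExtension ℚ K := ⟨hK.1⟩
    infer_instance
  obtain ⟨σ, hσ⟩ := ComplexEmbedding.exists_comp_symm_eq_of_comp_eq (k := ℚ) w₀.embedding ιK
    (by ext x; simp)
  set τ : K →+* K := ((σ.symm : K ≃ₐ[ℚ] K) : K →+* K) with hτdef
  have hτ : ∀ x, τ (τ x) = x := by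
    intro x
    have hcard : Nat.card (K ≃ₐ[ℚ] K) = 2 := by rw [IsGalois.card_aut_eq_finrank, hK.1]
    have hsq : σ.symm * σ.symm = 1 := by
      have h := pow_card_eq_one' (G := K ≃ₐ[ℚ] K) (x := σ.symm)
      rwa [hcard, pow_two] at h
    have := congrArg (fun g : K ≃ₐ[ℚ] K ↦ g x) hsq
    simpa [hτdef, AlgEquiv.mul_apply] using this
  -- the Galois conjugate `P' = τ_* P` is the Heegner point read through `w₀.embedding`
  set P' := WeierstrassCurve.Affine.Point.map τ.toRatAlgHom P with hP'def
  have hP' : WeierstrassCurve.Affine.Point.map w₀.embedding.toRatAlgHom P' =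
      heegnerPointComplex Dt H := by
    rw [hP'def, WeierstrassCurve.Affine.Point.map_map]
    have hcomp : w₀.embedding.toRatAlgHom.comp τ.toRatAlgHom = ιK.toRatAlgHom := by
      apply AlgHom.ext
      intro x
      have := RingHom.congr_fun hσ x
      simpa [hτdef] using this
    rw [hcomp]
    exact hP
  have hlog : ∀ e : K →+* ℚ_[p], padicLogOrd W p e P' = padicLogOrd W p e P := fun e ↦
    R1.padicLogOrd_map_eq_of_rank_one W p e P hp2 τ hτ hrk hPinf
  -- THE embedding at `𝔭` induces `𝔭`
  have hemb : ∀ k : 𝓞 K, k ∈ 𝔭.asIdeal ↔ ‖embAt K p 𝔭 h𝔭 he hf (k : K)‖ < 1 :=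
    mem_asIdeal_iff_norm_embAt_lt_one 𝔭 h𝔭 he hf
  -- every degree-one prime above `p` is induced by `ι₀` or by `ι₀ ∘ conj`
  have key : ∀ ι' : PadicAlgCl p ≃+* ℂ, 𝔭 = primeOfEmbeddingDatum p ι' w₀.embedding →
      IMCLowerWaldspurgerOnTreeAt p κ 𝔭 γ (embAt K p 𝔭 h𝔭 he hf) P := by
    intro ι' h𝔭eq
    subst h𝔭eq
    obtain ⟨ΩK, Ωp, Q, -, -, -, ⟨u, hu1, hu⟩, hdiv⟩ :=
      hF' ι' w₀ P' hP' (embAt K p _ h𝔭 he hf) hemb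
    refine imcLowerWaldspurgerOnTreeAt_of_padicLogOrd_eq W p _ (hlog _) ?_
    exact R1.imcLowerWaldspurgerOnTreeAt_of_intValue_of_intDvd hn hdiv hu1.le (W.LFunction p) hu
  rcases eq_primeOfEmbeddingDatum_or_eq_trans_starRingAut p ι₀ hK w₀ h𝔭 with h | h
  · exact key ι₀ h
  · exact key _ h

/-- **ROUTE p2's OPEN INPUT FROM H∃♭, ON EVERY PAIR** — no semistability, no `h32`, no `R₀`:
`hnf` (modularity), `hGZK`, `hKo` (Kolyvagin), the CITED `hPT` (Poitou–Tate) and `hEP` (local Euler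
characteristic) — through `p2ControlUpperOnTreeAt_of_facts`, the one-sided control being a tree theorem
on every pair since gen 17 — and the ONE typed shape `P2.IMCDivIntFrameOnTree W p`. CONDITIONAL on it.
[cite: Castella2018, Thms. 2.3, 3.1, 3.2, §5 (arXiv:1704.06608 pp. 5, 9, 12)]
[cite: Castella2018Erratum, (2.4) (p. 4)] [cite: MilneADT2006, Ch. I, Thm. 4.10(b) and Thm. 2.8] -/
theorem P2.openInputOnTreeAt_of_imcDivIntFrame (hnf : exists_isNewformOf)
    (hGZK : rank_eq_analyticRank_of_analyticRank_le_one)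
    (hKo : ∀ (N : ℕ) [NeZero N] (W : WeierstrassCurve ℚ) (K : Type) [Field K] [NumberField K],
      kolyvagin N W K)
    (hPT : ∀ (K : Type) [Field K] [NumberField K], poitouTate_sum_localTatePairing_eq_zero K)
    (hEP : ∀ (K : Type) [Field K] [NumberField K] (v : HeightOneSpectrum (𝓞 K)),
      localEulerPoincareCharacteristic (v.adicCompletion K))
    (hF : P2.IMCDivIntFrameOnTree W p) : P2OpenInputOnTreeAt W p := by
  obtain ⟨ι₀⟩ := PadicAlgCl.nonempty_ringEquiv_complex p
  exact P2.openInputOnTreeAt_of_imcDivIntFrame_of_controlUpper hnf hGZK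
    (p2ControlUpperOnTreeAt_of_facts W p hKo hPT hEP) ι₀ hF

/-- **The main-conjecture half on ANY X11b ∧ surj pair at `p ≥ 5` from published + cited facts and
H∃♭ AT THE PAIR.** [cite: Castella2018Erratum, (2.4) (p. 4)] [cite: Castella2018, Thms. 2.3, 3.2]
[cite: JetchevSkinnerWan2017, §7.4.1 (pp. 30–31)] [cite: Wuthrich2014, Prop. 21 (p. 400)] [cite: Miller2011LMS, Def. 1.1] -/
theorem P2.missingLowerBoundAt_of_imcDivIntFrame
    (hGZ : ∀ (N : ℕ) [NeZero N] (W : WeierstrassCurve ℚ) (K : Type) [Field K] [NumberField K],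
      gross_zagier N W K)
    (hKo : ∀ (N : ℕ) [NeZero N] (W : WeierstrassCurve ℚ) (K : Type) [Field K] [NumberField K],
      kolyvagin N W K)
    (hWu : sha_dvd_analyticSha) (hGZK : rank_eq_analyticRank_of_analyticRank_le_one)
    (hnf : exists_isNewformOf) (hHL : HoffsteinLuo1997_exists_twist_L_one_ne_zero)
    (hMaz : mazur_not_dvd_maninConstant_of_odd)
    (hPT : ∀ (K : Type) [Field K] [NumberField K], poitouTate_sum_localTatePairing_eq_zero K)
    (hEP : ∀ (K : Type) [Field K] [NumberField K] (v : HeightOneSpectrum (𝓞 K)),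
      localEulerPoincareCharacteristic (v.adicCompletion K))
    (hF : P2.IMCDivIntFrameOnTree W p) (hX : ClassX11b W p) (hp5 : 5 ≤ p) (hsurj : Surj W p) :
    Typed.MissingLowerBoundAt W p :=
  P2.missingLowerBoundAt_of_openInputAt W p hGZ hKo hWu hGZK
    (hasEntireLFunction_rat_of_exists_isNewformOf hnf) hnf hHL hMaz hPT hEP
    (P2.openInputOnTreeAt_of_imcDivIntFrame hnf hGZK hKo hPT hEP hF) hX hp5 hsurj

/-- **A1 — ANY Locus pair, semistable or not (2 093 111 ‖ 61 629): `BSD(E,p)` from published + cited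
facts and H∃♭ AT THE PAIR — NOTHING per pair, no `R₀`.** Gen 18's `P2.bsdp_of_locus_endState` with
the composite open input assembled from H∃♭; the upper half is the THEOREM
`missingUpperBoundAt_of_classX11b_of_ram_of_not_dvd`. CONDITIONAL on H∃♭; nothing booked.
[cite: Castella2018Erratum, (2.4), Thm. 1.1 (pp. 1, 4)] [cite: Castella2018, Thms. 3.1–3.2, §5]
[cite: Skinner2016PacificMC, Thm. C (§1)] [cite: McCallumLMS1991, §1 Theorem (Kolyvagin), p. 296]
[cite: Miller2011LMS, Def. 1.1] -/
theorem P2.bsdp_of_locus_of_imcDivIntFrame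
    (hGZ : ∀ (N : ℕ) [NeZero N] (W : WeierstrassCurve ℚ) (K : Type) [Field K] [NumberField K],
      gross_zagier N W K)
    (hKo : ∀ (N : ℕ) [NeZero N] (W : WeierstrassCurve ℚ) (K : Type) [Field K] [NumberField K],
      kolyvagin N W K)
    (hB : ∀ (N : ℕ) [NeZero N] (W : WeierstrassCurve ℚ) (K : Type) [Field K] [NumberField K],
      Kolyvagin1990_padicValNat_card_sha_le N W K)
    (hSk : Skinner2016.thmC_padicValRat_bsd_rank_zero) (hWu : sha_dvd_analyticSha)
    (hGZK : rank_eq_analyticRank_of_analyticRank_le_one) (hnf : exists_isNewformOf)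
    (hHL : HoffsteinLuo1997_exists_twist_L_one_ne_zero) (hMaz : mazur_not_dvd_maninConstant_of_odd)
    (hPT : ∀ (K : Type) [Field K] [NumberField K], poitouTate_sum_localTatePairing_eq_zero K)
    (hEP : ∀ (K : Type) [Field K] [NumberField K] (v : HeightOneSpectrum (𝓞 K)),
      localEulerPoincareCharacteristic (v.adicCompletion K))
    (hF : P2.IMCDivIntFrameOnTree W p)
    (hX : ClassX11b W p) (hp5 : 5 ≤ p) (hram : Ram W p) (htam : ¬ p ∣ W.tamagawaProduct) :
    BSDp W p :=
  P2.bsdp_of_locus_endState W p hGZ hKo hB hSk hWu hGZK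
    (hasEntireLFunction_rat_of_exists_isNewformOf hnf) hnf hHL hMaz hPT hEP
    (P2.openInputOnTreeAt_of_imcDivIntFrame hnf hGZK hKo hPT hEP hF) hX hp5 hram htam

end Composite

end Summit.BirchSwinnertonDyer.Rank1Residual.X11b

end
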